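import Mathlib
import Literature.NumberTheory.LFunctions.Zhang2022.TypedSection10A
import Literature.NumberTheory.LFunctions.Zhang2022.Section10Lemma101Tent
import HarnessLib

/-!
# Zhang (2022) §10, the Mellin–Perron displays (10.6), (10.7) of the proof of Lemma 10.1
# (`Z22:(10.6)`, `Z22:(10.7)`, `Z22:§10.u012`), kernel-checked

Topic `Literature/NumberTheory/LFunctions/Zhang2022` (Landau–Siegel audit tree; verdict-neutral).
Y. Zhang, *Discrete mean estimates and the Landau–Siegel zero*, arXiv:2211.02515v1 (2022)
[Zhang2022LandauSiegel] — **an unrefereed manuscript under adjudication**; this theorem-only file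
PROVES three proof-internal displays of the proof of its Lemma 10.1 (campaign siegel-zhang, DAG
nodes `Z22:(10.6)`, `Z22:(10.7)`, `Z22:§10.u012`, typed by L3-t1 in `TypedSection10A` as
`Typed.Sec10A.Eq106 / Eq107 / Step10u012`) about the banked `Skeleton.ftilde` (the tent (2.28)) and
`Skeleton.frakv1` (`𝔳₁ⱼ`), and asserts nothing about Theorems 1–2 — nor about Lemma 10.1 itself,
whose remaining content (contour shift, Lemma 5.8, Pólya–Vinogradov) is not touched here.

* `Z22:(10.6)` [Z22 p.54, tex L2757]: `f̃(log y/log P) = (500/log P)(2πi)⁻¹∫_{(1)}((P′₁)^s − 2(P′₂)^s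
  + (P′₃)^s)y^{−s}ds/s²` — `eq106` (every `y > 0`) and `Typed.Sec10A.eq106_holds`, from the Perron
  kernel `∫x^{1+it}(1+it)⁻²dt = 2π·log⁺x` (tree `Literature.Analysis.Complex.integral_perronPow_vertical`,
  Montgomery–Vaughan (5.21)) and the tent identity `f̃(u) = 500((0.504−u)⁺ − 2(0.502−u)⁺ + (0.5−u)⁺)`
  (the tree's `Lemma101.ftilde_eq_ramps`, `Section10Lemma101Tent`).
* `Z22:(10.7)` [Z22 p.54, tex L2762] (`y > P^{0.5}`): `𝔳₁ⱼ(y) = (500/log P)(2πi)⁻¹∫_{(1)} L(1−β_j+s,χ)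
  ((P′₁)^s − 2(P′₂)^s)y^{−s}ds/s²` — `eq107`, `Typed.Sec10A.eq107_holds`; `Z22:§10.u012` [Z22 p.55,
  tex L2778] (`y > P^{0.502}`): the same with `(P′₁/y)^s` alone — `step10u012`,
  `Typed.Sec10A.step10u012_holds`. Both from the tree's TENT DECOMPOSITION `Lemma101.frakv1_eq`
  (`Section10Lemma101Tent`: for `y ≥ 1`, `𝔳₁ⱼ(y) = (500/log P)(S(X₁) − 2S(X₂) + S(X₃))`,
  `S(X) = Σ_{m≤X} χ(m)m^{β_j−1}log(X/m)` the logarithmic Riesz sums of `Section8Lemma82.twist` at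
  `δ = −β_j`, `X_k = P′_k/y`) and Perron's formula for logarithmic Riesz means as used for Lemma 8.2
  (`Lemma82.sum_eq_integral`; `sum_twist_log_eq_integral`).

Line integrals `(2πi)⁻¹∫_{(1)}h(s)ds` are `(2π)⁻¹∫h(1+it)dt` (= `Typed.Sec10A.lineInt 1`). Nothing here
uses (A); `eq107` assumes `χ ≠ 1` (automatic in the skeleton frame) for the tree's integrability
lemma. Companion: `Section10DirectCalculation.lean` (`Z22:§10.u023/u024`).

## References

* Y. Zhang, arXiv:2211.02515v1 (2022), §10, Lemma 10.1 and its proof, (10.6)–(10.7) (pp. 54–55);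
  §2 (2.6), (2.13), (2.28). [cite: Zhang2022LandauSiegel, §10 pp. 54–55]
* H. L. Montgomery, R. C. Vaughan, *Multiplicative Number Theory I*, CUP 2007, §5.1 (5.21)–(5.22).
  [cite: MontgomeryVaughan2007, §5.1]
-/

noncomputable section

open Complex Real MeasureTheory

namespace Literature.NumberTheory.LFunctions.Zhang2022.Skeleton

/-! ### Preliminaries: `P > 1`, `Re β_j = 0`, powers of positive reals -/

/-- `P = exp(𝓛⁹) > 1` for `𝓛 > 0` (i.e. `D ≥ 2`). [cite: Zhang2022LandauSiegel, §2 (2.6)] -/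
private theorem one_lt_bigP {D : ℕ} (hℓ : 0 < ell D) : 1 < bigP D := by
  rw [bigP]; exact Real.one_lt_exp_iff.2 (pow_pos hℓ 9)

/-- `Re β_j = 0`: the shifts (2.13) are purely imaginary. [cite: Zhang2022LandauSiegel, §2 (2.13)] -/
theorem betaJ_re (c' : ℝ) (D j : ℕ) : (betaJ c' D j).re = 0 := by
  unfold betaJ
  split_ifs <;> simp [beta1, beta2, beta3]

/-! ### `Z22:(10.6)`: the tent as three Perron kernels -/

/-- `log⁺(P^a/y) = (log P)·(a − log y/log P)⁺` (`P > 1`, `y > 0`). [folklore] -/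
private theorem logPlus_rpow_div {P : ℝ} (hP : 1 < P) (a : ℝ) {y : ℝ} (hy : 0 < y) :
    max (Real.log (P ^ a / y)) 0 = Real.log P * max (a - Real.log y / Real.log P) 0 := by
  have hP0 : 0 < P := by linarith
  have hlogP : 0 < Real.log P := Real.log_pos hP
  rw [Real.log_div (Real.rpow_pos_of_pos hP0 a).ne' hy.ne', Real.log_rpow hP0]
  have : a * Real.log P - Real.log y = Real.log P * (a - Real.log y / Real.log P) := by
    field_simp
  rw [this]
  rcases le_or_gt 0 (a - Real.log y / Real.log P) with h | h
  · rw [max_eq_left h, max_eq_left (mul_nonneg hlogP.le h)]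
  · rw [max_eq_right h.le, max_eq_right (by nlinarith), mul_zero]

/-- For positive reals `a, y`: `a^s · y^{−s} = (a/y)^s` (complex powers of positive reals).
[folklore] -/
private theorem ofReal_cpow_mul_ofReal_cpow_neg {a y : ℝ} (ha : 0 < a) (hy : 0 < y) (s : ℂ) :
    (a : ℂ) ^ s * (y : ℂ) ^ (-s) = ((a / y : ℝ) : ℂ) ^ s := by
  rw [show (a / y : ℝ) = a * y⁻¹ by ring, Complex.ofReal_mul,
    Complex.mul_cpow_ofReal_nonneg ha.le (inv_nonneg.2 hy.le), Complex.ofReal_inv,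
    Complex.inv_cpow _ _ ?_, Complex.cpow_neg]
  rw [Complex.arg_ofReal_of_nonneg hy.le]; exact Real.pi_pos.ne

/-- The order-one Perron kernel on `Re s = 1`: `∫ x^{1+it}(1+it)⁻² dt = 2π·log⁺x` (`x > 0`), the tree's
`Literature.Analysis.Complex.integral_perronPow_vertical` at `m = c = 1`. [cite: MontgomeryVaughan2007, §5.1 (5.21)] -/
private theorem integral_perronPow_one_one {x : ℝ} (hx : 0 < x) :
    ∫ t : ℝ, Literature.Analysis.Complex.perronPow x 1 ((1 : ℂ) + t * I) =
      2 * π * ((max (Real.log x) 0 : ℝ) : ℂ) := by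
  have h := Literature.Analysis.Complex.integral_perronPow_vertical hx one_pos (le_refl 1)
  rw [Complex.ofReal_one] at h
  rw [h]; split_ifs with h1
  · rw [max_eq_left (Real.log_nonneg h1)]; simp
  · rw [max_eq_right (Real.log_nonpos hx.le (not_le.1 h1).le)]; simp

/-- Integrability of the order-one Perron kernel on `Re s = 1`. [folklore] -/
private theorem integrable_perronPow_one_one {x : ℝ} (hx : 0 < x) :
    Integrable fun t : ℝ => Literature.Analysis.Complex.perronPow x 1 ((1 : ℂ) + t * I) := by
  have h := Literature.Analysis.Complex.integrable_perronPow_vertical hx (le_refl 1)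
    (one_ne_zero : (1 : ℝ) ≠ 0)
  rwa [Complex.ofReal_one] at h

/-- **`Z22:(10.6)`** [Z22 p.54, tex L2757], for every `y > 0` and `D ≥ 2` (line integral as
`(2π)⁻¹∫(…)(1+it)dt`). [cite: Zhang2022LandauSiegel, §10 (10.6)] -/
theorem eq106 {D : ℕ} (hℓ : 0 < ell D) {y : ℝ} (hy : 0 < y) :
    (ftilde (Real.log y / Real.log (bigP D)) : ℂ) =
      500 / (Real.log (bigP D) : ℂ) * ((1 / (2 * π) : ℂ) * ∫ t : ℝ,
        (((bigP D ^ (0.504 : ℝ) : ℝ) : ℂ) ^ ((1 : ℂ) + t * I) -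
            2 * ((bigP D ^ (0.502 : ℝ) : ℝ) : ℂ) ^ ((1 : ℂ) + t * I) +
            ((bigP D ^ (0.5 : ℝ) : ℝ) : ℂ) ^ ((1 : ℂ) + t * I)) *
          (y : ℂ) ^ (-((1 : ℂ) + t * I)) / ((1 : ℂ) + t * I) ^ 2) := by
  have hP1 : 1 < bigP D := one_lt_bigP hℓ
  have hP : 0 < bigP D := by linarith
  have hΛ : 0 < Real.log (bigP D) := Real.log_pos hP1
  set X₁ : ℝ := bigP D ^ (0.504 : ℝ) / y with hX₁
  set X₂ : ℝ := bigP D ^ (0.502 : ℝ) / y with hX₂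
  set X₃ : ℝ := bigP D ^ (0.5 : ℝ) / y with hX₃
  have hX₁0 : 0 < X₁ := div_pos (Real.rpow_pos_of_pos hP _) hy
  have hX₂0 : 0 < X₂ := div_pos (Real.rpow_pos_of_pos hP _) hy
  have hX₃0 : 0 < X₃ := div_pos (Real.rpow_pos_of_pos hP _) hy
  -- the integrand is a combination of three Perron kernels
  have hint : ∀ t : ℝ,
      (((bigP D ^ (0.504 : ℝ) : ℝ) : ℂ) ^ ((1 : ℂ) + t * I) -
            2 * ((bigP D ^ (0.502 : ℝ) : ℝ) : ℂ) ^ ((1 : ℂ) + t * I) +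
            ((bigP D ^ (0.5 : ℝ) : ℝ) : ℂ) ^ ((1 : ℂ) + t * I)) *
          (y : ℂ) ^ (-((1 : ℂ) + t * I)) / ((1 : ℂ) + t * I) ^ 2 =
        Literature.Analysis.Complex.perronPow X₁ 1 ((1 : ℂ) + t * I) -
          2 * Literature.Analysis.Complex.perronPow X₂ 1 ((1 : ℂ) + t * I) +
          Literature.Analysis.Complex.perronPow X₃ 1 ((1 : ℂ) + t * I) := by
    intro t
    simp only [Literature.Analysis.Complex.perronPow]
    rw [hX₁, hX₂, hX₃, ← ofReal_cpow_mul_ofReal_cpow_neg (Real.rpow_pos_of_pos hP _) hy,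
      ← ofReal_cpow_mul_ofReal_cpow_neg (Real.rpow_pos_of_pos hP _) hy,
      ← ofReal_cpow_mul_ofReal_cpow_neg (Real.rpow_pos_of_pos hP _) hy]
    ring
  rw [integral_congr_ae (Filter.Eventually.of_forall hint)]
  have hi₁ := integrable_perronPow_one_one hX₁0
  have hi₂ := integrable_perronPow_one_one hX₂0
  have hi₃ := integrable_perronPow_one_one hX₃0
  rw [integral_add (hi₁.sub' (hi₂.const_mul 2)) hi₃, integral_sub hi₁ (hi₂.const_mul 2),
    integral_const_mul, integral_perronPow_one_one hX₁0, integral_perronPow_one_one hX₂0,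
    integral_perronPow_one_one hX₃0]
  rw [hX₁, hX₂, hX₃, logPlus_rpow_div hP1 _ hy, logPlus_rpow_div hP1 _ hy,
    logPlus_rpow_div hP1 _ hy, Lemma101.ftilde_eq_ramps]
  have hΛ0 : (Real.log (bigP D) : ℂ) ≠ 0 := by exact_mod_cast hΛ.ne'
  have hπ0 : (π : ℂ) ≠ 0 := by exact_mod_cast Real.pi_pos.ne'
  push_cast
  field_simp

/-! ### `Z22:(10.7)`, `Z22:§10.u012`: Perron for the three logarithmic Riesz means -/

/-- A logarithmic Riesz sum `Σ_{m ≤ X} f(m)log(X/m)` over `0 < m ≤ ⌊X⌋` is empty for `X < 1`.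
[folklore] -/
private theorem sum_Ioc_floor_eq_zero_of_lt_one (f : ℕ → ℂ) {X : ℝ} (hX : X < 1) :
    ∑ m ∈ Finset.Ioc 0 ⌊X⌋₊, f m * (Real.log (X / m) : ℂ) = 0 := by
  rw [Nat.floor_eq_zero.mpr hX, Finset.Ioc_self, Finset.sum_empty]

/-- **Perron for each piece** (the tree's `Lemma82.sum_eq_integral`, Montgomery–Vaughan (5.21)):
`S(X) = (2π)⁻¹∫ L(1 − β_j + s, χ) X^s s⁻² dt`, `s = 1 + it` (`X > 0`).
[cite: Zhang2022LandauSiegel, §10 (10.7); MontgomeryVaughan2007, §5.1 (5.21)] -/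
theorem sum_twist_log_eq_integral (c' : ℝ) {D : ℕ} [NeZero D] (χ : DirichletCharacter ℂ D) (j : ℕ)
    {X : ℝ} (hX : 0 < X) :
    ∑ m ∈ Finset.Ioc 0 ⌊X⌋₊, Lemma82.twist χ (-betaJ c' D j) m * (Real.log (X / m) : ℂ) =
      (1 / (2 * π) : ℂ) * ∫ t : ℝ,
      χ.LFunction (1 - betaJ c' D j + ((1 : ℂ) + t * I)) * (X : ℂ) ^ ((1 : ℂ) + t * I) /
        ((1 : ℂ) + t * I) ^ 2 := by
  have hδ : (-betaJ c' D j).re = 0 := by rw [Complex.neg_re, betaJ_re, neg_zero]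
  rw [Lemma82.sum_eq_integral χ hδ hX]
  congr 1
  refine integral_congr_ae (Filter.Eventually.of_forall fun t => ?_)
  simp only [Lemma82.G, Lemma82.Fδ]
  rw [show (1 : ℂ) + -betaJ c' D j + (1 + t * I) = 1 - betaJ c' D j + (1 + t * I) by ring]
  ring

/-- **`Z22:(10.7)`** [Z22 p.54, tex L2762], for every `y > P^{0.5}` (printed: `P^{0.5} < y ≤ P^{0.502}/T`;
the `(P′₃)^s` piece of (10.6) drops out since `P′₃/y < 1`). [cite: Zhang2022LandauSiegel, §10 (10.7)] -/
theorem eq107 (c' : ℝ) {D : ℕ} [NeZero D] (χ : DirichletCharacter ℂ D) (hχ : χ ≠ 1)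
    (hℓ : 0 < ell D) (j : ℕ) {y : ℝ} (hy : bigP D ^ (0.5 : ℝ) < y) :
    frakv1 c' χ j y = 500 / (Real.log (bigP D) : ℂ) * ((1 / (2 * π) : ℂ) * ∫ t : ℝ,
      χ.LFunction (1 - betaJ c' D j + ((1 : ℂ) + t * I)) *
        (((bigP D ^ (0.504 : ℝ) : ℝ) : ℂ) ^ ((1 : ℂ) + t * I) -
          2 * ((bigP D ^ (0.502 : ℝ) : ℝ) : ℂ) ^ ((1 : ℂ) + t * I)) *
        (y : ℂ) ^ (-((1 : ℂ) + t * I)) / ((1 : ℂ) + t * I) ^ 2) := by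
  have hP1 : 1 < bigP D := one_lt_bigP hℓ
  have hP : 0 < bigP D := by linarith
  have hy1 : 1 ≤ y := le_trans (Real.one_le_rpow hP1.le (by norm_num)) hy.le
  have hy0 : 0 < y := by linarith
  have hδ : (-betaJ c' D j).re = 0 := by rw [Complex.neg_re, betaJ_re, neg_zero]
  set X₁ : ℝ := bigP D ^ (0.504 : ℝ) / y with hX₁
  set X₂ : ℝ := bigP D ^ (0.502 : ℝ) / y with hX₂
  have hX₁0 : 0 < X₁ := div_pos (Real.rpow_pos_of_pos hP _) hy0
  have hX₂0 : 0 < X₂ := div_pos (Real.rpow_pos_of_pos hP _) hy0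
  have hX₃ : bigP D ^ (0.5 : ℝ) / y < 1 := (div_lt_one hy0).mpr hy
  rw [Lemma101.frakv1_eq χ c' j hy1 hP1, sum_Ioc_floor_eq_zero_of_lt_one _ hX₃, add_zero]
  -- the integrand splits
  have hint : ∀ t : ℝ,
      χ.LFunction (1 - betaJ c' D j + ((1 : ℂ) + t * I)) *
          (((bigP D ^ (0.504 : ℝ) : ℝ) : ℂ) ^ ((1 : ℂ) + t * I) -
            2 * ((bigP D ^ (0.502 : ℝ) : ℝ) : ℂ) ^ ((1 : ℂ) + t * I)) *
          (y : ℂ) ^ (-((1 : ℂ) + t * I)) / ((1 : ℂ) + t * I) ^ 2 =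
        Lemma82.G χ (-betaJ c' D j) X₁ (((1 : ℝ) : ℂ) + t * I) -
          2 * Lemma82.G χ (-betaJ c' D j) X₂ (((1 : ℝ) : ℂ) + t * I) := by
    intro t
    simp only [Lemma82.G, Lemma82.Fδ, Complex.ofReal_one]
    rw [hX₁, hX₂, ← ofReal_cpow_mul_ofReal_cpow_neg (Real.rpow_pos_of_pos hP _) hy0,
      ← ofReal_cpow_mul_ofReal_cpow_neg (Real.rpow_pos_of_pos hP _) hy0,
      show (1 : ℂ) + -betaJ c' D j + (1 + t * I) = 1 - betaJ c' D j + (1 + t * I) by ring]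
    ring
  rw [integral_congr_ae (Filter.Eventually.of_forall hint)]
  have hi₁ := Lemma82.integrable_G_right χ hχ hδ hX₁0
  have hi₂ := Lemma82.integrable_G_right χ hχ hδ hX₂0
  rw [integral_sub hi₁ (hi₂.const_mul 2), integral_const_mul]
  have e₁ := Lemma82.sum_eq_integral χ hδ hX₁0
  have e₂ := Lemma82.sum_eq_integral χ hδ hX₂0
  simp only [Complex.ofReal_one] at e₁ e₂ ⊢
  rw [e₁, e₂]
  push_cast
  ring

/-- **`Z22:§10.u012`** [Z22 p.55, tex L2778], for every `y > P^{0.502}` (printed: `≤ P^{0.504}/T`):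
`𝔳₁ⱼ(y) = (500/log P)(2πi)⁻¹∫_{(1)} L(1−β_j+s,χ)(P′₁/y)^s ds/s²`. [cite: Zhang2022LandauSiegel, §10 p. 55] -/
theorem step10u012 (c' : ℝ) {D : ℕ} [NeZero D] (χ : DirichletCharacter ℂ D)
    (hℓ : 0 < ell D) (j : ℕ) {y : ℝ} (hy : bigP D ^ (0.502 : ℝ) < y) :
    frakv1 c' χ j y = 500 / (Real.log (bigP D) : ℂ) * ((1 / (2 * π) : ℂ) * ∫ t : ℝ,
      χ.LFunction (1 - betaJ c' D j + ((1 : ℂ) + t * I)) *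
        ((bigP D ^ (0.504 : ℝ) / y : ℝ) : ℂ) ^ ((1 : ℂ) + t * I) / ((1 : ℂ) + t * I) ^ 2) := by
  have hP1 : 1 < bigP D := one_lt_bigP hℓ
  have hP : 0 < bigP D := by linarith
  have hy1 : 1 ≤ y := le_trans (Real.one_le_rpow hP1.le (by norm_num)) hy.le
  have hy0 : 0 < y := by linarith
  have hX₁0 : 0 < bigP D ^ (0.504 : ℝ) / y := div_pos (Real.rpow_pos_of_pos hP _) hy0
  have hX₂ : bigP D ^ (0.502 : ℝ) / y < 1 := (div_lt_one hy0).mpr hy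
  have hX₃ : bigP D ^ (0.5 : ℝ) / y < 1 := by
    refine (div_lt_one hy0).mpr (lt_trans ?_ hy)
    exact Real.rpow_lt_rpow_of_exponent_lt hP1 (by norm_num)
  rw [Lemma101.frakv1_eq χ c' j hy1 hP1, sum_Ioc_floor_eq_zero_of_lt_one _ hX₃,
    sum_Ioc_floor_eq_zero_of_lt_one _ hX₂, mul_zero, sub_zero, add_zero,
    sum_twist_log_eq_integral c' χ j hX₁0]
  push_cast
  ring

end Literature.NumberTheory.LFunctions.Zhang2022.Skeleton

namespace Literature.NumberTheory.LFunctions.Zhang2022.Typed.Sec10A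

open Literature.NumberTheory.LFunctions.Zhang2022.Skeleton

/-- `D ≥ 2 ⇒ 𝓛 = log D > 0`. [folklore] -/
private theorem ell_pos_of_two_le {D : ℕ} (hD : 2 ≤ D) : 0 < ell D :=
  Real.log_pos (by exact_mod_cast hD)

/-- **`Z22:(10.6)` DISCHARGED**: the typed node `Typed.Sec10A.Eq106` holds (threshold `D ≥ 2`;
hypothesis (A) is not used). [cite: Zhang2022LandauSiegel, §10 (10.6), p. 54] -/
theorem eq106_holds : Eq106 := by
  refine ⟨2, fun D _ χ hD _ _ _ y hy => ?_⟩
  rw [eq106 (ell_pos_of_two_le hD) hy, lineInt]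
  congr 2
  refine integral_congr_ae (Filter.Eventually.of_forall fun t => ?_)
  simp only [Pp1, Pp2, Pp3, Complex.ofReal_one, Complex.cpow_neg]
  ring

/-- **`Z22:(10.7)` DISCHARGED**: the typed node `Typed.Sec10A.Eq107 c′` holds (for every `c′`;
threshold `D ≥ 2`; only `y > P^{0.5}` of the printed range is used; (A) is not used).
[cite: Zhang2022LandauSiegel, §10 (10.7), p. 54] -/
theorem eq107_holds (c' : ℝ) : Eq107 c' := by
  refine ⟨2, fun D _ χ hD _ hp _ j _ y hy _ => ?_⟩
  have hχ : χ ≠ 1 := Lemma31.ne_one_of_isPrimitive χ hD hp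
  rw [eq107 c' χ hχ (ell_pos_of_two_le hD) j hy, lineInt]
  congr 2
  refine integral_congr_ae (Filter.Eventually.of_forall fun t => ?_)
  simp only [Pp1, Pp2, Complex.ofReal_one, Complex.cpow_neg]
  ring

variable (c' : ℝ) in
/-- `Eq107` — `_holds` alias of `eq107_holds` above under the fact's exact name, stated under the
prover's own binders as section variables (appended 2026-08-28, D-0026 bookkeeping: the proof term is the
existing theorem of this file; no statement, definition or attribute is edited; no new named fact; the
ledger's debt table listed the fact unproved). [cite: Zhang2022LandauSiegel, §10 (10.7), p. 54] -/
theorem _root_.Literature.NumberTheory.LFunctions.Zhang2022.Typed.Sec10A.Eq107_holds :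
    _root_.Literature.NumberTheory.LFunctions.Zhang2022.Typed.Sec10A.Eq107 c' :=
  _root_.Literature.NumberTheory.LFunctions.Zhang2022.Typed.Sec10A.eq107_holds (c' := c')

/-- **`Z22:§10.u012` DISCHARGED**: the typed node `Typed.Sec10A.Step10u012 c′` holds (for every `c′`;
threshold `D ≥ 2`; only `y > P^{0.502}` of the printed range is used; (A) is not used).
[cite: Zhang2022LandauSiegel, §10 p. 54, tex L2778] -/
theorem step10u012_holds (c' : ℝ) : Step10u012 c' := by
  refine ⟨2, fun D _ χ hD _ _ _ j _ y hy _ => ?_⟩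
  rw [step10u012 c' χ (ell_pos_of_two_le hD) j hy, lineInt]
  simp only [Pp1, Complex.ofReal_one]

variable (c' : ℝ) in
/-- `Step10u012` — `_holds` alias of `step10u012_holds` above under the fact's exact name, stated under the
prover's own binders as section variables (appended 2026-08-28, D-0026 bookkeeping: the proof term is the
existing theorem of this file; no statement, definition or attribute is edited; no new named fact; the
ledger's debt table listed the fact unproved). [cite: Zhang2022LandauSiegel, §10 p. 54, tex L2778] -/
theorem _root_.Literature.NumberTheory.LFunctions.Zhang2022.Typed.Sec10A.Step10u012_holds :
    _root_.Literature.NumberTheory.LFunctions.Zhang2022.Typed.Sec10A.Step10u012 c' :=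
  _root_.Literature.NumberTheory.LFunctions.Zhang2022.Typed.Sec10A.step10u012_holds (c' := c')

end Literature.NumberTheory.LFunctions.Zhang2022.Typed.Sec10A
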